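import Literature.AlgebraicGeometry.HodgeTheory.NoTypeIVFactorProductFactors
import Literature.AlgebraicGeometry.HodgeTheory.NoTypeIVFactorIffCentreTotallyReal
import Literature.AlgebraicGeometry.HodgeTheory.AbelianVarietyHOneSummandMultiplicitiesProducts
import Literature.AlgebraicGeometry.Motives.AbelianVarietyIdempotentRelations
import HarnessLib

/-!
# «No simple factor of type IV» literally: a complex abelian variety `X` has no factor of type IV iff every
# simple factor of (any) isotypic decomposition `X ∼ ∏ B_q^{m_q}` has totally real centre `Z(End⁰ B_q)`, iff
# `X` is isogenous to a product of powers of simple abelian varieties of Albert types I–III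
# (Mumford §19 Cor. 1–2; Moonen–Zarhin 1999 §1; Shimura §5.1 Prop. 5)

Family `hodge`, layer `Literature/AlgebraicGeometry/HodgeTheory`; THEOREMS ONLY — no definition, no named fact, no
`sorry` (D-0026, net debt 0). Lane `lit-hodgefound` (Track 2 foundations library), prover seat `lit-hodgefound-p21`,
generation 29, row g29-#3: the VALIDATION of the tree's elementwise predicate `HasNoTypeIVFactor`
(`HodgeGroupProductCMFactor`: every central element of `End⁰(X)` is killed by a non-zero rational polynomial with only
real roots) against the printed notion. Inputs: g29-#2 `NoTypeIVFactorProductFactors`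
(`hasNoTypeIVFactor_iff_forall_of_isIsogenous_biproduct_powers`: for `X ∼ ⨁_q ⨁_{Fin (m_q+1)} B_q`,
`HasNoTypeIVFactor X ↔ ∀ q, HasNoTypeIVFactor (B_q)`), the seat's `NoTypeIVFactorIffCentreTotallyReal`
(`hasNoTypeIVFactor_iff_isTotallyReal_centerField`: for `B` SIMPLE, `HasNoTypeIVFactor B ↔` the number field
`CenterField B = Z(End⁰ B)` is totally real; `not_hasNoTypeIVFactor_iff_isCMField_centerField`), the tree's isotypic
decomposition `AbelianVariety.exists_isIsogenous_biproduct_powers` (Mumford §19 Cor. 1) and `dim ⨁ = Σ dim`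
(`AbelianVariety.sum_dim_biproduct`, `IsIsogenous.dim_eq`).

PUBLISHED STATEMENTS. Moonen–Zarhin, Math. Ann. 315 (1999) §1: for `X` simple, `D = End⁰(X)`, `F = Cent(D)`:
«Type I–III: `F` totally real; Type IV: `F` a CM field»; «If `X` has no factors of Type 4 then `Hg(X)` is
semi-simple»; Moonen–Zarhin, Duke Math. J. 77 (1995) / *Weil classes* (1998) §1: «we say that `X` and `Y` are of type
1, 2, 3 or 4 if the algebra `D` is of the corresponding type» (for `X ∼ Yᵐ`, `Y` simple). Mumford §19 Cor. 1 (every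
`X` is isogenous to `∏ Xᵢ^{nᵢ}`, `Xᵢ` simple pairwise non-isogenous) and Cor. 2 (`End⁰(X) = ⊕ M_{nᵢ}(Dᵢ)`, so
`Z(End⁰ X) = ⊕ Z(Dᵢ)`). Shimura 1998 §5.1 Prop. 5 (p. 36): the centre of `End⁰` of a simple abelian variety is
totally real or a CM field.

MAIN RESULTS (all proved):
* §1 `AbelianVariety.nonempty_index_of_isIsogenous_biproduct` — a positive-dimensional `X ∼ ⨁ᵢ Bᵢ` has a non-empty
  index set; `hasNoTypeIVFactor_iff_forall_of_isIsogenous_biproduct_powers_of_dim_pos` (g29-#2 §4 without the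
  `Nonempty` instance).
* §2 **`hasNoTypeIVFactor_iff_forall_isTotallyReal_centerField`** — for `X ∼ ⨁_q ⨁_{Fin (m_q+1)} B_q` with the `B_q`
  SIMPLE of positive dimension: `HasNoTypeIVFactor X ↔ ∀ q, IsTotallyReal (CenterField (B q))`;
  **`not_hasNoTypeIVFactor_iff_exists_isCMField_centerField`** — `X` HAS a factor of type IV iff some `Z(End⁰ B_q)`
  is a CM field.
* §3 decomposition-free forms through Mumford §19 Cor. 1: **`hasNoTypeIVFactor_iff_exists_decomposition_totallyReal`**
  (`0 < dim X`: `HasNoTypeIVFactor X` iff `X` is isogenous to SOME `⨁_q ⨁ B_q` with simple `B_q` of totally real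
  centre — «a product of powers of simple abelian varieties of types I–III») and
  **`hasNoTypeIVFactor_iff_forall_decomposition_totallyReal`** (iff in EVERY such decomposition all centres are
  totally real); `not_hasNoTypeIVFactor_iff_exists_decomposition_isCMField`.

## References

* [MoonenZarhin1999LowDim] B. Moonen, Yu. Zarhin, Math. Ann. 315 (1999), §1 (types; «no factors of Type 4»).
  [cite: MoonenZarhin1999LowDim, §1 and Thm. (3.2)]
* [MoonenZarhin1998WeilClasses] B. Moonen, Yu. Zarhin, *Weil classes on abelian varieties*, §1 (chunk p0002 L45–L51).
  [cite: MoonenZarhin1998WeilClasses, §1 (chunk p0002 L45–L51)]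
* [MumfordAV1970] D. Mumford, *Abelian Varieties*, §19 Cor. 1 and Cor. 2 (p. 174). [cite: MumfordAV1970, §19 Cor. 2 (p. 174)]
* [Shimura1998] G. Shimura, *Abelian Varieties with Complex Multiplication and Modular Functions*, §5.1 Prop. 5 (p. 36).
  [cite: Shimura1998, §5.1 Proposition 5 (p. 36)]
* [LangeBirkenhake1992] H. Lange, Ch. Birkenhake, *Complex Abelian Varieties*, §5.5. [cite: LangeBirkenhake1992, §5.5]
-/

noncomputable section

open CategoryTheory CategoryTheory.Limits NumberField
open Literature.AlgebraicGeometry.Motives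
open Literature.AlgebraicGeometry.ComplexMultiplication (CenterField)

/-! ### §1 A positive-dimensional variety isogenous to a biproduct has a non-empty index set -/

namespace Literature.AlgebraicGeometry.Motives

namespace AbelianVariety

/-- `0 < dim X` and `X ∼ ⨁ᵢ Bᵢ` force the index type to be non-empty (`dim ⨁ᵢ Bᵢ = Σᵢ dim Bᵢ`, and isogenous
varieties have the same dimension). [cite: MumfordAV1970, §19 Cor. 1 and Cor. 2 (p. 174)] -/
theorem nonempty_index_of_isIsogenous_biproduct {X : AbelianVariety ℂ} {ι : Type} [Fintype ι] [DecidableEq ι]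
    {B : ι → AbelianVariety ℂ} (hX0 : 0 < X.dim) (hX : IsIsogenous X (⨁ B)) : Nonempty ι := by
  by_contra hι
  rw [not_nonempty_iff] at hι
  have h := hX.dim_eq
  rw [← Literature.AlgebraicGeometry.HodgeTheory.AbelianVariety.sum_dim_biproduct, Finset.univ_eq_empty,
    Finset.sum_empty] at h
  omega

end AbelianVariety

end Literature.AlgebraicGeometry.Motives

namespace Literature.AlgebraicGeometry.HodgeTheory

/-- g29-#2 §4 for positive-dimensional `X`, without the `Nonempty` instance: for `X ∼ ⨁_q ⨁_{Fin (m_q+1)} B_q`,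
`HasNoTypeIVFactor X ↔ ∀ q, HasNoTypeIVFactor (B_q)`. [cite: MoonenZarhin1999LowDim, §1 and Thm. (3.2)]
[cite: MumfordAV1970, §19 Cor. 1 and Cor. 2 (p. 174)] -/
theorem hasNoTypeIVFactor_iff_forall_of_isIsogenous_biproduct_powers_of_dim_pos {X : AbelianVariety ℂ} {Q : Type}
    [Fintype Q] [DecidableEq Q] (B : Q → AbelianVariety ℂ) (m : Q → ℕ) (hX0 : 0 < X.dim)
    (hX : AbelianVariety.IsIsogenous X (⨁ fun q => ⨁ fun _ : Fin (m q + 1) => B q)) :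
    HasNoTypeIVFactor X ↔ ∀ q, HasNoTypeIVFactor (B q) := by
  haveI := AbelianVariety.nonempty_index_of_isIsogenous_biproduct hX0 hX
  exact hasNoTypeIVFactor_iff_forall_of_isIsogenous_biproduct_powers B m hX

/-! ### §2 The type of `X` is read on its simple factors: totally real centres -/

/-- **`X` has no factor of type IV iff every simple factor of an isotypic decomposition of `X` has totally real
centre**: for `X ∼ ⨁_q ⨁_{Fin (m_q+1)} B_q` with the `B_q` simple of positive dimension (the shape of
`AbelianVariety.exists_isIsogenous_biproduct_powers`; pairwise non-isogeny is not needed),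
`HasNoTypeIVFactor X ↔ ∀ q, IsTotallyReal (Z(End⁰ B_q))`. Types I–III ⟺ totally real centre (Moonen–Zarhin §1;
Shimura §5.1 Prop. 5). [cite: MoonenZarhin1999LowDim, §1 and Thm. (3.2)]
[cite: MoonenZarhin1998WeilClasses, §1 (chunk p0002 L45–L51)] [cite: Shimura1998, §5.1 Proposition 5 (p. 36)] -/
theorem hasNoTypeIVFactor_iff_forall_isTotallyReal_centerField {X : AbelianVariety ℂ} {Q : Type} [Fintype Q]
    [DecidableEq Q] [Nonempty Q] {B : Q → AbelianVariety ℂ} {m : Q → ℕ}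
    (hS : ∀ q, AbelianVariety.IsSimple (B q)) (hd : ∀ q, 0 < (B q).dim)
    (hX : AbelianVariety.IsIsogenous X (⨁ fun q => ⨁ fun _ : Fin (m q + 1) => B q)) :
    HasNoTypeIVFactor X ↔ ∀ q, IsTotallyReal (CenterField (B q) (hS q) (hd q)) := by
  rw [hasNoTypeIVFactor_iff_forall_of_isIsogenous_biproduct_powers B m hX]
  exact forall_congr' fun q => hasNoTypeIVFactor_iff_isTotallyReal_centerField (hS q) (hd q)

/-- The same for positive-dimensional `X` without the `Nonempty` instance. [cite: MoonenZarhin1999LowDim, §1 and Thm. (3.2)]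
[cite: Shimura1998, §5.1 Proposition 5 (p. 36)] -/
theorem hasNoTypeIVFactor_iff_forall_isTotallyReal_centerField_of_dim_pos {X : AbelianVariety ℂ} {Q : Type}
    [Fintype Q] [DecidableEq Q] {B : Q → AbelianVariety ℂ} {m : Q → ℕ}
    (hS : ∀ q, AbelianVariety.IsSimple (B q)) (hd : ∀ q, 0 < (B q).dim) (hX0 : 0 < X.dim)
    (hX : AbelianVariety.IsIsogenous X (⨁ fun q => ⨁ fun _ : Fin (m q + 1) => B q)) :
    HasNoTypeIVFactor X ↔ ∀ q, IsTotallyReal (CenterField (B q) (hS q) (hd q)) := by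
  haveI := AbelianVariety.nonempty_index_of_isIsogenous_biproduct hX0 hX
  exact hasNoTypeIVFactor_iff_forall_isTotallyReal_centerField hS hd hX

/-- **`X` HAS a simple factor of type IV iff some simple factor of an isotypic decomposition has CM centre**:
`¬ HasNoTypeIVFactor X ↔ ∃ q, IsCMField (Z(End⁰ B_q))` (the centre of a simple `End⁰` is totally real or CM,
the tree's `center_isTotallyReal_or_isCMField_of_isSimple`, packaged in `not_hasNoTypeIVFactor_iff_isCMField_centerField`).
[cite: MoonenZarhin1999LowDim, §1 and Thm. (3.2)] [cite: Shimura1998, §5.1 Proposition 5 (p. 36)]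
[cite: LangeBirkenhake1992, §5.5 (type IV: the centre is a CM field)] -/
theorem not_hasNoTypeIVFactor_iff_exists_isCMField_centerField {X : AbelianVariety ℂ} {Q : Type} [Fintype Q]
    [DecidableEq Q] [Nonempty Q] {B : Q → AbelianVariety ℂ} {m : Q → ℕ}
    (hS : ∀ q, AbelianVariety.IsSimple (B q)) (hd : ∀ q, 0 < (B q).dim)
    (hX : AbelianVariety.IsIsogenous X (⨁ fun q => ⨁ fun _ : Fin (m q + 1) => B q)) :
    ¬ HasNoTypeIVFactor X ↔ ∃ q, IsCMField (CenterField (B q) (hS q) (hd q)) := by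
  rw [hasNoTypeIVFactor_iff_forall_of_isIsogenous_biproduct_powers B m hX, not_forall]
  exact exists_congr fun q => not_hasNoTypeIVFactor_iff_isCMField_centerField (hS q) (hd q)

/-- A simple factor with CM centre witnesses a type-IV factor: for `X ∼ ⨁_q ⨁ B_q` as above and some `q` with
`Z(End⁰ B_q)` a CM field, `¬ HasNoTypeIVFactor X`. [cite: MoonenZarhin1999LowDim, §1 and Thm. (3.2)]
[cite: Shimura1998, §5.1 Proposition 5 (p. 36)] -/
theorem not_hasNoTypeIVFactor_of_isCMField_centerField_factor {X : AbelianVariety ℂ} {Q : Type} [Fintype Q]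
    [DecidableEq Q] {B : Q → AbelianVariety ℂ} {m : Q → ℕ}
    (hS : ∀ q, AbelianVariety.IsSimple (B q)) (hd : ∀ q, 0 < (B q).dim)
    (hX : AbelianVariety.IsIsogenous X (⨁ fun q => ⨁ fun _ : Fin (m q + 1) => B q)) (q : Q)
    (hq : IsCMField (CenterField (B q) (hS q) (hd q))) : ¬ HasNoTypeIVFactor X := by
  haveI : Nonempty Q := ⟨q⟩
  exact (not_hasNoTypeIVFactor_iff_exists_isCMField_centerField hS hd hX).2 ⟨q, hq⟩

/-! ### §3 Decomposition-free forms (Mumford §19 Cor. 1: an isotypic decomposition exists) -/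

/-- **`X` (of positive dimension) has no factor of type IV iff `X` is isogenous to a product of powers of simple
abelian varieties with totally real centres** — «a product of powers of simple abelian varieties of types I–III».
(`→`: Mumford §19 Cor. 1 gives `X ∼ ⨁_q ⨁ B_q` with simple `B_q`, and §2 reads the centres; `←`: §2.)
[cite: MumfordAV1970, §19 Cor. 1 and Cor. 2 (p. 174)] [cite: MoonenZarhin1999LowDim, §1 and Thm. (3.2)]
[cite: Shimura1998, §5.1 Proposition 5 (p. 36)] -/
theorem hasNoTypeIVFactor_iff_exists_decomposition_totallyReal {X : AbelianVariety ℂ} (hX0 : 0 < X.dim) :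
    HasNoTypeIVFactor X ↔ ∃ (Q : Type) (_ : Fintype Q) (_ : DecidableEq Q) (B : Q → AbelianVariety ℂ) (m : Q → ℕ)
      (hS : ∀ q, AbelianVariety.IsSimple (B q)) (hd : ∀ q, 0 < (B q).dim),
      AbelianVariety.IsIsogenous X (⨁ fun q => ⨁ fun _ : Fin (m q + 1) => B q) ∧
        ∀ q, IsTotallyReal (CenterField (B q) (hS q) (hd q)) := by
  constructor
  · intro h
    obtain ⟨Q, _, _, B, m, hS, hd, -, hX⟩ := AbelianVariety.exists_isIsogenous_biproduct_powers X
    exact ⟨Q, inferInstance, inferInstance, B, m, hS, hd, hX,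
      (hasNoTypeIVFactor_iff_forall_isTotallyReal_centerField_of_dim_pos hS hd hX0 hX).1 h⟩
  · rintro ⟨Q, _, _, B, m, hS, hd, hX, hT⟩
    exact (hasNoTypeIVFactor_iff_forall_isTotallyReal_centerField_of_dim_pos hS hd hX0 hX).2 hT

/-- **… iff in EVERY decomposition `X ∼ ⨁_q ⨁ B_q` into powers of simple factors all centres `Z(End⁰ B_q)` are
totally real** (the simple factors are unique up to isogeny, so this is the same condition; proved here directly
from §2, without the uniqueness theorem). [cite: MumfordAV1970, §19 Cor. 1 and Cor. 2 (p. 174)]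
[cite: MoonenZarhin1999LowDim, §1 and Thm. (3.2)] [cite: Shimura1998, §5.1 Proposition 5 (p. 36)] -/
theorem hasNoTypeIVFactor_iff_forall_decomposition_totallyReal {X : AbelianVariety ℂ} (hX0 : 0 < X.dim) :
    HasNoTypeIVFactor X ↔ ∀ (Q : Type) (_ : Fintype Q) (_ : DecidableEq Q) (B : Q → AbelianVariety ℂ) (m : Q → ℕ)
      (hS : ∀ q, AbelianVariety.IsSimple (B q)) (hd : ∀ q, 0 < (B q).dim),
      AbelianVariety.IsIsogenous X (⨁ fun q => ⨁ fun _ : Fin (m q + 1) => B q) →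
        ∀ q, IsTotallyReal (CenterField (B q) (hS q) (hd q)) := by
  constructor
  · intro h Q _ _ B m hS hd hX
    exact (hasNoTypeIVFactor_iff_forall_isTotallyReal_centerField_of_dim_pos hS hd hX0 hX).1 h
  · intro h
    obtain ⟨Q, _, _, B, m, hS, hd, -, hX⟩ := AbelianVariety.exists_isIsogenous_biproduct_powers X
    exact (hasNoTypeIVFactor_iff_forall_isTotallyReal_centerField_of_dim_pos hS hd hX0 hX).2
      (h Q inferInstance inferInstance B m hS hd hX)

/-- **`X` (of positive dimension) has a factor of type IV iff some decomposition into powers of simple factors has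
a factor with CM centre.** [cite: MumfordAV1970, §19 Cor. 1 and Cor. 2 (p. 174)] [cite: MoonenZarhin1999LowDim, §1 and Thm. (3.2)]
[cite: Shimura1998, §5.1 Proposition 5 (p. 36)] [cite: LangeBirkenhake1992, §5.5 (type IV: the centre is a CM field)] -/
theorem not_hasNoTypeIVFactor_iff_exists_decomposition_isCMField {X : AbelianVariety ℂ} (hX0 : 0 < X.dim) :
    ¬ HasNoTypeIVFactor X ↔ ∃ (Q : Type) (_ : Fintype Q) (_ : DecidableEq Q) (B : Q → AbelianVariety ℂ) (m : Q → ℕ)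
      (hS : ∀ q, AbelianVariety.IsSimple (B q)) (hd : ∀ q, 0 < (B q).dim),
      AbelianVariety.IsIsogenous X (⨁ fun q => ⨁ fun _ : Fin (m q + 1) => B q) ∧
        ∃ q, IsCMField (CenterField (B q) (hS q) (hd q)) := by
  constructor
  · intro h
    obtain ⟨Q, _, _, B, m, hS, hd, -, hX⟩ := AbelianVariety.exists_isIsogenous_biproduct_powers X
    haveI := AbelianVariety.nonempty_index_of_isIsogenous_biproduct hX0 hX
    exact ⟨Q, inferInstance, inferInstance, B, m, hS, hd, hX,
      (not_hasNoTypeIVFactor_iff_exists_isCMField_centerField hS hd hX).1 h⟩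
  · rintro ⟨Q, _, _, B, m, hS, hd, hX, q, hq⟩
    exact not_hasNoTypeIVFactor_of_isCMField_centerField_factor hS hd hX q hq

end Literature.AlgebraicGeometry.HodgeTheory

end
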